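import Summits.QuantumFields.YangMills.Theorems.BalabanUVNodesN16PinnedLooseMatchOfReg910Slot
import Summits.QuantumFields.YangMills.Theorems.BalabanUVNodesN16H7OfN07RecordSlotKey

/-!
# Route «BalabanUVNodes», crux K3⁷ `SpineGivenEndpointR13SepCoPH` (stmt-QuantumFields-20544), skeleton v5 941dddb108cbaacf — node N16 = NE3: THE N07 → N16 EDGE BY NAME AT NODE N07's
# RECORD SLOT, RE-KEYED TO THE SLOT TRANSFER — module 46's `…_b11Leaf_transfer_match` (whose pair `B11Leaf ∧ Thm1AtTransfer04to42` is FALSE at N = 2, dag-n16-w2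
# `…N16Thm1AtTorusVPSmallCubesConsequences`) with dag-n16-w1's SLOT-KEYED transfer `Thm1AtTransfer04toSlot F N ζ B₀` (file 10 `…N16H7OfN07RecordSlotKey`, p6xxxxx) in place of the
# refuted all-cube one: v5's three N16 conjuncts ⟸ `h5` ∧ (∀ F, ∃ ζ B₀, B11Leaf (Z11OfRecord F N ζ) ∧ Thm1AtTransfer04toSlot F N ζ B₀), via module 47 at `G := lipGauge`

Cell `pub-ymgap`, seat `pub-ymgap-dag-n16-e` (R134 (a), strategy s2 = BY-NAME KNIT at the record; D-0062; chair R424 venue), generation 16, module 48 (THEOREMS ONLY, 0 `def`, 0 `sorry`,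
standard axioms).  `--kind proof --supports stmt-QuantumFields-20544 --as helper` (count-neutral; proves NO registered stub).  `bears_on: R4∕N16 · edges N05 → N16, N07 → N16 (N07 at its
RECORD SLOT) · out-edge N16 → N19 ∕ N21`.  Over module 47 `…N16PinnedLooseMatchOfReg910Slot` (p615316: the slot-keyed v5 producer), dag-n16-w1's files 3 ∕ 10 `…N16H7OfN07RecordSlot[Key]`
(`lipGauge`, `radiiMono_lipGauge'`, `interface_lipGauge'`, `Thm1AtTransfer04toSlot`) and NODE 00's `exists_thm1At_of_b11Leaf_Z11OfRecord` — CITED BY NAME, none edited.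

THE POINT.  Node N07's statement OF RECORD is its K1-side slot `B11Leaf (Z11OfRecord F N ζ)` ([Balaban1985Variational] Thm 1 at NODE 00's (0.4)-objects).  The (0.4) → (42) passage
(located averaging pin) in its REPAIRED, slot-keyed form is dag-n16-w1's ONE displayed hypothesis `Thm1AtTransfer04toSlot F N ζ B₀ := (K1 Thm 1) → ∃ C', C'.B₃ ≤ B₀ ∧ (T9ˢ: Thm 1's
(9)–(10) for minimisers over `sfClass (B₃ε₁)` with `ε₁`-loose data on the SLOT cubes, at `lipGauge`) ∧ (T8: (8))`.  So module 47 applies at `G := lipGauge` with the (T9ˢ) component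
as its `hR`: ★ `exists_letters_n16HolderAtReading_loose_of_h5_b11Leaf_transferSlot_match` (+ `…_n19rows`).  With this, N16's share of `stub_rates13H`'s witness reads off THE DAG's OWN
NODE STATEMENTS — N05's edge at the pinned members (`h5`) and N07's K1 leaf of record (`h07`) — plus ONE located dictionary row (the slot transfer), none of them refuted.

HONEST FRAMING.  Kernel bookkeeping by name; no estimate; `h5`, `h07 : B11Leaf (Z11OfRecord F N ζ)` (node N07's content) and the slot transfer (a located hypothesis SHAPE, not a theorem
of print or of the tree) are DISPLAYED, asserted for no family; nothing of Bałaban asserted; no stub closed; N16 ∕ N07 ∕ N19 NOT discharged; the skeleton is the planner's and is NOT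
edited; counts UNMOVED (typed 28∕28 · discharged 5∕27, A 5∕28); one finite four-torus at fixed ε — NOT ℝ⁴ ∕ infinite volume ∕ OS ∕ mass gap ∕ Clay.
-/

set_option autoImplicit false

open scoped BigOperators Matrix Matrix.Norms.L2Operator
open NormedSpace

namespace Summit.QuantumFields.YangMills.BalabanUVNodes.N16PinnedLooseMatchOfN07SlotKey

open Literature.MathematicalPhysics.QuantumFieldTheory.Balaban1983to89
open Literature.MathematicalPhysics.QuantumFieldTheory.Balaban1983to89.T4Continuum (T4Family ULoop)
open B7Prop1Explicit B7Prop2Explicit MatrixLog UnitaryModel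
open T4AveragingDeficitWall hiding Site Plaq Bond
open B7Prop3Flat (c3)
open B8LeafModelZd (ZdIdx)
open B8LeafModelZd3 (zdGF3)
open Node00 (Stage13HParams NE3Objects₁₁ NE3Letters₁₁ ne3ConstLayerOfRecord₁₁ ne3NperOfRecord₁₁ ne3DomOfRecord₁₁ MatA ZIdx ResidZ Z11OfRecord
  exists_thm1At_of_b11Leaf_Z11OfRecord)
open Summit.QuantumFields.BalabanUV.T4Continuum
open MinimalActionRate (sfClass)
open MinimalActionRefine (gradConst)
open MinimalActionDictionary (torusVP RadiiMono)
open AveragingDeficitLatticeH2Prep (fd)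
open B11Thm1 (Thm1At)
open DagBinding (B11Leaf)
open YMDAG.UVSplit (NE3Carriers ne3OfRecord₁₁ RateReading₁₃CoPH rateCarriersOfRecord₁₃CoPH)
open Summit.QuantumFields.YangMills.BalabanUVNodes.N16HolderDefs (N16HolderAt)
open Summit.QuantumFields.YangMills.BalabanUVNodes.N16PinnedLayer13CoPH (N16PinnedLoose N16LettersEnd N16HolderAtReading)
open MinimalActionSandwich (IsMinimiser)
open B11 (Regularity)
open Summit.QuantumFields.YangMills.BalabanUVNodes.N16H7OfN07RecordSlot (lipGauge radiiMono_lipGauge' interface_lipGauge')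
open Summit.QuantumFields.YangMills.BalabanUVNodes.N16H7OfN07RecordSlotKey (Thm1AtTransfer04toSlot)
open Summit.QuantumFields.YangMills.BalabanUVNodes.N16PinnedLooseMatchOfReg910Slot (exists_letters_n16HolderAtReading_loose_of_h5_reg910Slot_match
  exists_letters_n16HolderAtReading_loose_of_h5_reg910Slot_match_n19rows)

noncomputable section

variable {N : ℕ} [NeZero N] {β : ℝ} (hβ0 : 0 ≤ β) (hβ1 : β ≤ 1)
include hβ0 hβ1

/-- **★ THE N07 → N16 EDGE BY NAME AT NODE N07's RECORD SLOT — v5's THREE N16 CONJUNCTS.**  Node N05's `h5` (37ᴴ's, VERBATIM), `g F > 0`, and per family node N07's K1-side leaf of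
record `B11Leaf (Z11OfRecord F N ζ)` together with dag-n16-w1's displayed SLOT-KEYED (0.4)→(42) transfer `Thm1AtTransfer04toSlot F N ζ B₀` (any letter `B₀`) give letters `ℓ₃` and a
radius letter `B` with THE END's rows `N16LettersEnd N g ℓ₃`, the MATCH row `∀ F, 0 < B F ∧ (ℓ₃ F).ε ∕ B F ≤ (ℓ₃ F).b` (= `N16RadiusMatch ℓ₃ B`), and the N16 conjunct at EVERY
reading pinned LOOSE at `ℓ₃, B`.  Proof: `exists_thm1At_of_b11Leaf_Z11OfRecord` ∘ the slot transfer give the SLOT KEY at `torusVP … (lipGauge 4 (Fin N)) (k+1)`; module 47 at `G := lipGauge` (interface `radiiMono_lipGauge'` ∕ `interface_lipGauge'`). [cite: Balaban1985Variational, Thm 1 (8)–(10) p.279] [folklore] -/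
theorem exists_letters_n16HolderAtReading_loose_of_h5_b11Leaf_transferSlot_match {g : T4Family → ℝ} (hg : ∀ F, 0 < g F)
    (h5 : ∀ F : T4Family, letI : CStarAlgebra (Matrix (Fin N) (Fin N) ℂ) := {}
      ∃ (len : Site 4 → ℝ) (c₁ c₁' B₁' cP C₂ B₀β : ℝ) (inp : B8.B9Inputs),
        (∀ v : Site 4, 0 < len v → 1 ≤ len v) ∧ (∀ μ : Fin 4, len (e μ) = 1) ∧ 0 < B₁' ∧ 5 * ((4 : ℕ) : ℝ) * F.L * inp.B₀ ≤ B₁' ∧ 0 < c₁' ∧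
        (∀ α₀ α₁ : ℝ, 0 < α₀ → 0 < α₁ → α₀ + α₁ ≤ c₁' →
          α₀ + α₁ ≤ c₁ ∧ C0 4 * (2 * α₀) ≤ 1 / 3 ∧ 4 * α₀ ≤ c2' 4 F.L ∧ 16 * (B₁' * (α₀ + α₁)) ≤ 1 ∧
          Real.exp (4 * (800 * (((4 : ℕ) : ℝ) + 1) ^ 2 * (((4 : ℕ) : ℝ) + 4)) * α₀) * (1 + 8 * (131072 * (((4 : ℕ) : ℝ) + 1) ^ 2) * (B₁' * (α₀ + α₁))) ≤ 2 ∧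
          2 * (B₁' * (α₀ + α₁)) ≤ c3 4 F.L ∧ ((4 : ℕ) : ℝ) * F.L * α₁ ≤ 1 / 8 ∧ α₀ ≤ cP ∧ α₁ ≤ cP ∧ B₁' * (α₀ + α₁) ≤ cP ∧
          2 * (B₁' * (α₀ + α₁)) ^ 2 + 20 * ((4 : ℕ) : ℝ) * α₀ * (B₁' * (α₀ + α₁)) + 2 * C₂ * (B₁' * (α₀ + α₁)) ^ 2 ≤ α₀ + α₁) ∧
        B8.Thm4Body c₁ B₁' (fun i : {i : ZdIdx 4 F.L // (∀ j, i.Ω j = Set.univ) ∧ (∀ m j, i.Λs m j = {_y | j = m}) ∧ (∀ m j, i.Λb m j = {_c | j = m}) ∧ i.η = ((F.L : ℝ)⁻¹) ^ i.k} => (zdGF3 (Matrix (Fin N) (Fin N) ℂ) F.L β len i.1).toGFData) ∧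
        B8.Prop3Body cP 4 (F.L : ℝ) C₂ inp B₀β (fun i : {i : ZdIdx 4 F.L // (∀ j, i.Ω j = Set.univ) ∧ (∀ m j, i.Λs m j = {_y | j = m}) ∧ (∀ m j, i.Λb m j = {_c | j = m}) ∧ i.η = ((F.L : ℝ)⁻¹) ^ i.k} => (zdGF3 (Matrix (Fin N) (Fin N) ℂ) F.L β len i.1).toGFData2))
    (h07 : ∀ F : T4Family, ∃ (ζ : ResidZ F N) (B₀ : ℝ), B11Leaf (Z11OfRecord F N ζ) ∧ Thm1AtTransfer04toSlot F N ζ B₀) :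
    ∃ (ℓ₃ : T4Family → NE3Letters₁₁) (B : T4Family → ℝ), N16LettersEnd N g ℓ₃ ∧
      (∀ F : T4Family, 0 < B F ∧ (ℓ₃ F).ε / B F ≤ (ℓ₃ F).b) ∧
      ∀ 𝔯 : RateReading₁₃CoPH N, N16PinnedLoose 𝔯 ℓ₃ B → N16HolderAtReading 𝔯 β := by
  -- per family: node N07's slot ⟹ Theorem 1 at NODE 00's (0.4)-objects ⟹ (transfer) Theorem 1 at leaf-06's (42)-torus instances in the `lipGauge` shape
  choose ζ B₀ h07' hT using h07
  choose C' hC' using fun F => hT F (exists_thm1At_of_b11Leaf_Z11OfRecord (h07' F))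
  obtain ⟨ℓ₃, B, hL, hM, -, hH⟩ := exists_letters_n16HolderAtReading_loose_of_h5_reg910Slot_match (N := N) hβ0 hβ1 hg h5
    (G := fun _ => lipGauge 4 (Fin N)) (fun _ => radiiMono_lipGauge')
    (fun _ U x K α₀ α₁ α₂ hK hGU => interface_lipGauge' U x K α₀ α₁ α₂ hK hGU) C' (fun F => (hC' F).2.1)
  exact ⟨ℓ₃, B, hL, hM, hH⟩

/-- **★ THE SAME WITH NODE N19's TWO FURTHER RADIUS GUARDS** (`ε∕B ≤ 1∕4`, `4·(ε∕B) ≤ c'` with `gradConst 4 c' = g F`) — module 47's `…_match_n19rows` at the record-slot inputs;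
typed ahead for (t-N16b). [cite: Balaban1985Variational, Thm 1 (8)–(10) p.279] [folklore] -/
theorem exists_letters_n16HolderAtReading_loose_of_h5_b11Leaf_transferSlot_match_n19rows {g : T4Family → ℝ} (hg : ∀ F, 0 < g F)
    (h5 : ∀ F : T4Family, letI : CStarAlgebra (Matrix (Fin N) (Fin N) ℂ) := {}
      ∃ (len : Site 4 → ℝ) (c₁ c₁' B₁' cP C₂ B₀β : ℝ) (inp : B8.B9Inputs),
        (∀ v : Site 4, 0 < len v → 1 ≤ len v) ∧ (∀ μ : Fin 4, len (e μ) = 1) ∧ 0 < B₁' ∧ 5 * ((4 : ℕ) : ℝ) * F.L * inp.B₀ ≤ B₁' ∧ 0 < c₁' ∧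
        (∀ α₀ α₁ : ℝ, 0 < α₀ → 0 < α₁ → α₀ + α₁ ≤ c₁' →
          α₀ + α₁ ≤ c₁ ∧ C0 4 * (2 * α₀) ≤ 1 / 3 ∧ 4 * α₀ ≤ c2' 4 F.L ∧ 16 * (B₁' * (α₀ + α₁)) ≤ 1 ∧
          Real.exp (4 * (800 * (((4 : ℕ) : ℝ) + 1) ^ 2 * (((4 : ℕ) : ℝ) + 4)) * α₀) * (1 + 8 * (131072 * (((4 : ℕ) : ℝ) + 1) ^ 2) * (B₁' * (α₀ + α₁))) ≤ 2 ∧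
          2 * (B₁' * (α₀ + α₁)) ≤ c3 4 F.L ∧ ((4 : ℕ) : ℝ) * F.L * α₁ ≤ 1 / 8 ∧ α₀ ≤ cP ∧ α₁ ≤ cP ∧ B₁' * (α₀ + α₁) ≤ cP ∧
          2 * (B₁' * (α₀ + α₁)) ^ 2 + 20 * ((4 : ℕ) : ℝ) * α₀ * (B₁' * (α₀ + α₁)) + 2 * C₂ * (B₁' * (α₀ + α₁)) ^ 2 ≤ α₀ + α₁) ∧
        B8.Thm4Body c₁ B₁' (fun i : {i : ZdIdx 4 F.L // (∀ j, i.Ω j = Set.univ) ∧ (∀ m j, i.Λs m j = {_y | j = m}) ∧ (∀ m j, i.Λb m j = {_c | j = m}) ∧ i.η = ((F.L : ℝ)⁻¹) ^ i.k} => (zdGF3 (Matrix (Fin N) (Fin N) ℂ) F.L β len i.1).toGFData) ∧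
        B8.Prop3Body cP 4 (F.L : ℝ) C₂ inp B₀β (fun i : {i : ZdIdx 4 F.L // (∀ j, i.Ω j = Set.univ) ∧ (∀ m j, i.Λs m j = {_y | j = m}) ∧ (∀ m j, i.Λb m j = {_c | j = m}) ∧ i.η = ((F.L : ℝ)⁻¹) ^ i.k} => (zdGF3 (Matrix (Fin N) (Fin N) ℂ) F.L β len i.1).toGFData2))
    (h07 : ∀ F : T4Family, ∃ (ζ : ResidZ F N) (B₀ : ℝ), B11Leaf (Z11OfRecord F N ζ) ∧ Thm1AtTransfer04toSlot F N ζ B₀) :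
    ∃ (ℓ₃ : T4Family → NE3Letters₁₁) (B : T4Family → ℝ) (c' : T4Family → ℝ), N16LettersEnd N g ℓ₃ ∧
      (∀ F : T4Family, 0 < B F ∧ (ℓ₃ F).ε / B F ≤ (ℓ₃ F).b) ∧
      (∀ F : T4Family, 0 < c' F ∧ gradConst 4 (c' F) = g F ∧ (ℓ₃ F).ε / B F ≤ 1 / 4 ∧ 4 * ((ℓ₃ F).ε / B F) ≤ c' F) ∧
      ∀ 𝔯 : RateReading₁₃CoPH N, N16PinnedLoose 𝔯 ℓ₃ B → N16HolderAtReading 𝔯 β := by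
  choose ζ B₀ h07' hT using h07
  choose C' hC' using fun F => hT F (exists_thm1At_of_b11Leaf_Z11OfRecord (h07' F))
  obtain ⟨ℓ₃, B, c', hL, hM, -, hrows, hH⟩ := exists_letters_n16HolderAtReading_loose_of_h5_reg910Slot_match_n19rows (N := N) hβ0 hβ1 hg h5
    (G := fun _ => lipGauge 4 (Fin N)) (fun _ => radiiMono_lipGauge')
    (fun _ U x K α₀ α₁ α₂ hK hGU => interface_lipGauge' U x K α₀ α₁ α₂ hK hGU) C' (fun F => (hC' F).2.1)
  exact ⟨ℓ₃, B, c', hL, hM, hrows, hH⟩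

end

end Summit.QuantumFields.YangMills.BalabanUVNodes.N16PinnedLooseMatchOfN07SlotKey
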